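import Summits.ResolutionOfSingularities.ResolutionOfSingularities.Theorems.PurelyInseparableDim4WinCertLeafTorusCheck
import Summits.ResolutionOfSingularities.ResolutionOfSingularities.Theorems.PurelyInseparableDim4ScopeSymmetry
import Summits.ResolutionOfSingularities.ResolutionOfSingularities.Theorems.PurelyInseparableDim4InScopeTorus
import Mathlib.FieldTheory.IsAlgClosed.AlgebraicClosure
import HarnessLib
import HarnessLib.Audit.Tags

/-!
# Purely inseparable fourfolds — FCert v3 with TORUS FLATS (and still flats, `.rat` blind rows): the checker
# `twinCertBL` and its soundness over every field of characteristic `p`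
# [OURS · counted 0 · a certificate format for OUR frame v4, not about resolution]

Census cell «res-dim4-pi» (D-0157 DOOR 2), desk WORD #164 (b) «∀K RESIDUE»; seat res-rescue-typ-3 g10.  Sequel of
✓ `…WinCertLeafStill` (`lwinCertBLS`) and ✓ `…WinCertLeafTorusCore` (the torus identity).  A row may now carry
TORUS FLATS `(φ, certs)`: a coordinate flat `φ = (j, b0, U)` of the chart (`b0 = 0` on `U`) together with, for every
support pattern `W ⊆ U`, an exponent certificate `(W, d, m, l)`.  The clause `ltorusFlatOKB`: for every `W ⊆ U`,
(i) `torusPatternOKB q (normL c₀.L) W d m l` on the base child `c₀ = stepD q S j b0 s` (normalised term list) — for every term `(e, c)` of `c₀.L`,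
every box exponent `k` (`k ≤ e` on `W`, `k = e` off `W`) that survives cleaning satisfies
`d·(e_u − k_u) = m_u + Σᵢ kᵢ l_{u,i}` for `u ∈ W` — and (ii) some LATER row presents the 𝔽_p-point child
`stepD q S j (b0 + 1_W) s` (any row kind).  SOUNDNESS (`tedges_of_move`): a `K`-point `b = b0 + v` of the flat has
`supp v =: W`; in `K̄ = AlgebraicClosure K` pick `w_u^d = v_u`; by ✓ `TorusFlat.clean_translate_eq_torus` the child at
`b` is `μ · c_{1_W}(ν x)` with `μ = ∏ w_u^{m_u}`, `νᵢ = ∏ w_u^{l_{u,i}}`; the later row certifies `c_{1_W}` over `K̄`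
(the row invariant is quantified over ALL fields), ✓ `Torus.inScopeStateWins_C_mul_scale` moves the win along the
torus, and ✓ `ScopeSymmetry.inScopeStateWins_of_inScopeStateWins_map` descends it to `K`.  Everything else (replies,
ordinary and still flats, leaves, covers — torus flats count as flats for coverage) is ✓ `…WinCertLeafStill` verbatim.

* rows and checker: ✓ `…WinCertLeafTorusCheck` (`TRow`, `torusPatternOKB`, `ltorusFlatOKB`, `trowOKL`, `twinCertBL`);
* §1 soundness of one row (`tedges_of_move`, `trowGood_of_trowOK`); §2 **`forall_inScopeStateWins_of_twinCertBL`**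
  (`LeafSound p leafOK`) and **`forall_inScopeStateWins_of_twinCertBL5`** (`leafOK5`) — conclusion VERBATIM the landed one.
Why: root S1a-5637307d28 (the last band root outside the ∀K column) has no FCert v3 / still certificate (a 2-cycle
of base children whose first move must depend on the flat parameter); its flats are torus-absorbable.
Nothing here proves resolution of singularities in dimension ≥ 4 / characteristic `p`; F4-C(2,2) stays OPEN; the column
this feeds certifies `InScopeStateWins` on listed roots only.  Counted 0; AI work, weaker than expert review.
bears_on: LADDER-RESOLUTION:D157-DOOR2 (res-dim4-pi · F4-C ∀K column · FCert v3 torus-flat checker).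
Supports stmt-ResolutionOfSingularities-16155 (helper).
-/

set_option linter.dupNamespace false

noncomputable section
open MvPolynomial Finset
open scoped BigOperators
namespace Summit.ResolutionOfSingularities.ResolutionOfSingularities.Theorems.PIDim4

namespace WinCertLeaf

open Literature.AlgebraicGeometry.Resolution
open Literature.AlgebraicGeometry.Resolution.Hauser2010
open Literature.AlgebraicGeometry.Resolution.CentreBlowup
open StepKit WinCertSound InScopeWinCert ScopeCover ScopeBlind WinCertAllFields FlatAbsorb WinCertFlat WinCertSubst
open TorusFlat

/-! ## 1. Soundness of one row -/

variable {C : Type}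

/-- **The row invariant over ALL fields**: every row of `rest` is good along every base change. [folklore] -/
def AllGood (p : ℕ) [Fact p.Prime] (rest : List (TRow (ZMod p) C)) : Prop :=
  ∀ (K : Type) [Field K] [CharP K p] [DecidableEq K] (f : ZMod p →+* K), ∀ r ∈ rest, LRowGood f r.1

/-- The edges through the centre of a MOVE row all lead to in-scope escapable states (torus format). [folklore] -/
theorem tedges_of_move {p : ℕ} [Fact p.Prime] {K : Type} [Field K] [CharP K p] [DecidableEq K]
    (f : ZMod p →+* K) {leafOK : SData 4 (ZMod p) → Finset (Fin 4) → ILeaf (ZMod p) C → Bool}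
    (hs : LeafSound p leafOK) {rest : List (TRow (ZMod p) C)} (hrestAll : AllGood p rest) {row : TRow (ZMod p) C}
    (hall : lrepliesOKB p (rest.map Prod.fst) row.1.1.1 row.1.1.2.1 (allFlats row) row.1.2.2.2 = true)
    (hflats : lflatsOKBS p (rest.map Prod.fst) row.1.1.1 row.1.1.2.1 row.1.2.2.1 = true)
    (htor : ∀ ψ ∈ row.2, ltorusFlatOKB p (rest.map Prod.fst) row.1.1.1 row.1.1.2.1 ψ.1 ψ.2 = true)
    (hleaves : lleavesOKB leafOK row.1.1.1 row.1.1.2.1 row.1.2.2.2 = true)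
    (hcov : lcoversOKB p p row.1.1.1 row.1.1.2.1 row.1.2.1 (allFlats row) row.1.2.2.2 = true) :
    ∀ t, Edge p row.1.1.2.1 (lrowState f row.1) t → InScopeStateWins p t := by
  classical
  have hrest : ∀ r ∈ rest.map Prod.fst, LRowGood f r := by
    intro r hr
    obtain ⟨r', hr', rfl⟩ := List.mem_map.mp hr
    exact hrestAll K f r' hr'
  unfold lrepliesOKB at hall
  unfold lflatsOKBS at hflats
  unfold lleavesOKB at hleaves
  unfold lcoversOKB at hcov
  have hall' := of_decide_eq_true hall
  have hflats' := of_decide_eq_true hflats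
  have hleaves' := of_decide_eq_true hleaves
  have hcov' := of_decide_eq_true hcov
  -- abbreviations
  set srow := row.1.1.1 with hsrow
  set S := row.1.1.2.1 with hS
  -- the base change of a base child
  have hstepK : ∀ (K' : Type) [Field K'] [CharP K' p] [DecidableEq K'] (f' : ZMod p →+* K') (j : Fin 4)
      (b0 : Fin 4 → ZMod p), step p S j (f' ∘ b0) (lrowState f' row.1) =
        ⟨MvPolynomial.map f' (stepD p S j b0 srow).toState.F,
          (stepD p S j b0 srow).toState.r, (stepD p S j b0 srow).toState.exc⟩ := by
    intro K' _ _ _ f' j b0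
    rw [lrowState, BaseChange.step_map f' p S j b0 srow.toState, step_toState]
  -- an ORDINARY flat of chart `j` absorbs every `K`-point on it (FCert v3 / still)
  have hflat : ∀ (j : Fin 4) (φ : Flat (ZMod p)), φ ∈ row.1.2.2.1 → φ.j = j → ∀ b : Fin 4 → K, OnFlat f φ b →
      InScopeStateWins p (step p S j b (lrowState f row.1)) := by
    intro j φ hφ hφj b hb
    subst hφj
    obtain ⟨-, -, hbase⟩ := hflats' φ hφ
    obtain ⟨v, hv, rfl⟩ := exists_add_of_onFlat f hb
    have hstep := hstepK K f φ.j φ.b0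
    rcases lbaseOKS_cases hbase with hbase | ⟨hU, r, hr, hrc⟩
    · obtain ⟨r, hr, hrc, hnone, huniv, hpermr, hdisj⟩ := exists_of_lbaseOK hbase
      have hgood := (hrest r hr).2 hnone huniv
      have hF : (step p S φ.j (f ∘ φ.b0) (lrowState f row.1)).F = (lrowState f r).F := by
        rw [hstep, lrowState, hrc]
      refine inScopeStateWins_step_add_of_move (S' := r.1.2.1) (fun i hi => hv i ?_) ?_ ?_
      · exact fun hiU => (Finset.disjoint_left.mp hdisj) hi hiU
      · rw [hF]; exact hgood.1
      · intro t ht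
        obtain ⟨t', ht', hFt⟩ := edge_congr hF ht
        exact inScopeStateWins_congr (hgood.2 t' ht') t hFt
    · have hc : (step p S φ.j (f ∘ φ.b0) (lrowState f row.1)).F =
          MvPolynomial.map f (evalT (stepD p S φ.j φ.b0 srow).L) := by
        rw [hstep, SData.toState_F]
      have hsame := step_add_F_eq_of_noVars f S φ.j hv (f ∘ φ.b0) (lrowState f row.1) hc hU
      have hF : (step p S φ.j (f ∘ φ.b0) (lrowState f row.1)).F = (lrowState f r).F := by
        rw [hstep, lrowState, hrc]
      exact inScopeStateWins_congr (hrest r hr).1 _ (by rw [hsame, hF])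
  -- a TORUS flat of chart `j` absorbs every `K`-point on it
  have htflat : ∀ (j : Fin 4) (ψ : TFlat (ZMod p)), ψ ∈ row.2 → ψ.1.j = j → ∀ b : Fin 4 → K, OnFlat f ψ.1 b →
      InScopeStateWins p (step p S j b (lrowState f row.1)) := by
    intro j ψ hψ hψj b hb
    subst hψj
    obtain ⟨-, -, hU0, hWc⟩ := of_ltorusFlatOKB (htor ψ hψ)
    obtain ⟨v, hv, rfl⟩ := exists_add_of_onFlat f hb
    -- the support pattern of `v`
    set W : Finset (Fin 4) := Finset.univ.filter fun u => v u ≠ 0 with hWdef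
    have hWU : W ⊆ ψ.1.U := by
      intro u hu
      rw [hWdef, Finset.mem_filter] at hu
      by_contra huU
      exact hu.2 (hv u huU)
    have hvW : ∀ i, i ∉ W → v i = 0 := by
      intro i hi
      by_contra hne
      exact hi (by rw [hWdef, Finset.mem_filter]; exact ⟨Finset.mem_univ _, hne⟩)
    have hvW' : ∀ u ∈ W, v u ≠ 0 := fun u hu => by
      rw [hWdef, Finset.mem_filter] at hu; exact hu.2
    obtain ⟨⟨c, -, -, hpat⟩, r, hr, hrc⟩ := hWc W hWU
    obtain ⟨hd, hcert⟩ := cert_of_torusPatternOKB hpat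
    set d := c.2.1 with hdd
    set m := c.2.2.1 with hmm
    set l := c.2.2.2 with hll
    -- go to the algebraic closure
    let Kb : Type := AlgebraicClosure K
    let g : K →+* Kb := algebraMap K Kb
    haveI : DecidableEq Kb := Classical.decEq _
    let fb : ZMod p →+* Kb := g.comp f
    -- roots of the support coordinates
    have hroot : ∀ u, ∃ wu : Kb, u ∈ W → wu ^ d = g (v u) := by
      intro u
      by_cases hu : u ∈ W
      · obtain ⟨z, hz⟩ := IsAlgClosed.exists_pow_nat_eq (g (v u)) hd
        exact ⟨z, fun _ => hz⟩
      · exact ⟨1, fun h => absurd h hu⟩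
    choose w hw using hroot
    have hw0 : ∀ u ∈ W, w u ≠ 0 := by
      intro u hu h0
      have := hw u hu
      rw [h0, zero_pow (Nat.pos_iff_ne_zero.mp hd)] at this
      exact hvW' u hu (g.injective (by rw [map_zero]; exact this.symm))
    have hvbW : ∀ i, i ∉ W → (g ∘ v) i = 0 := fun i hi => by
      rw [Function.comp_apply, hvW i hi, map_zero]
    -- the child over `K̄`
    have hchild : (⟨MvPolynomial.map g (step p S ψ.1.j (f ∘ ψ.1.b0 + v) (lrowState f row.1)).F,
        (step p S ψ.1.j (f ∘ ψ.1.b0 + v) (lrowState f row.1)).r,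
        (step p S ψ.1.j (f ∘ ψ.1.b0 + v) (lrowState f row.1)).exc⟩ : State Kb) =
        step p S ψ.1.j (fb ∘ ψ.1.b0 + g ∘ v) (lrowState fb row.1) := by
      have hb : fb ∘ ψ.1.b0 + g ∘ v = g ∘ (f ∘ ψ.1.b0 + v) := by
        funext i; simp [fb, Function.comp_apply, map_add]
      rw [hb, show lrowState fb row.1 = (⟨MvPolynomial.map g (lrowState f row.1).F, (lrowState f row.1).r,
          (lrowState f row.1).exc⟩ : State Kb) from by
            simp only [lrowState, fb, MvPolynomial.map_map],
        BaseChange.step_map g p S ψ.1.j (f ∘ ψ.1.b0 + v) (lrowState f row.1)]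
    -- the torus identity over `K̄`
    have hstepb := hstepK Kb fb ψ.1.j ψ.1.b0
    have hc0 : (step p S ψ.1.j (fb ∘ ψ.1.b0) (lrowState fb row.1)).F =
        MvPolynomial.map fb (evalT (normL (stepD p S ψ.1.j ψ.1.b0 srow).L)) := by
      rw [hstepb, SData.toState_F, evalT_normL]
    have hone : fb ∘ (ψ.1.b0 + oneOnK W) = fb ∘ ψ.1.b0 + TorusFlat.oneOn W := by
      funext i
      simp only [Function.comp_apply, Pi.add_apply, map_add, oneOnK, TorusFlat.oneOn]
      split_ifs <;> simp
    have hstep1 := hstepK Kb fb ψ.1.j (ψ.1.b0 + oneOnK W)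
    rw [hone] at hstep1
    have hident : (step p S ψ.1.j (fb ∘ ψ.1.b0 + g ∘ v) (lrowState fb row.1)).F =
        MvPolynomial.C (∏ u ∈ W, w u ^ m u) * aeval (fun i => MvPolynomial.C (∏ u ∈ W, w u ^ l u i) * X i)
          (step p S ψ.1.j (fb ∘ ψ.1.b0 + TorusFlat.oneOn W) (lrowState fb row.1)).F := by
      rw [step_add_F, step_add_F, hc0]
      exact TorusFlat.clean_translate_eq_torus fb hvbW (fun u hu => hw u hu) hw0 m l _ hcert
    -- the later row certifies the 𝔽_p-point child over `K̄`
    have hF1 : (step p S ψ.1.j (fb ∘ ψ.1.b0 + TorusFlat.oneOn W) (lrowState fb row.1)).F = (lrowState fb r).F := by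
      rw [hstep1, lrowState, hrc]
    have hrestb : ∀ r ∈ rest.map Prod.fst, LRowGood fb r := by
      intro r' hr'
      obtain ⟨r'', hr'', rfl⟩ := List.mem_map.mp hr'
      exact hrestAll Kb fb r'' hr''
    have hwin1 : InScopeStateWins p (lrowState fb r) := (hrestb r hr).1
    -- move the win along the torus
    have hμ : (∏ u ∈ W, w u ^ m u) ≠ 0 :=
      Finset.prod_ne_zero_iff.mpr fun u hu => zpow_ne_zero _ (hw0 u hu)
    have hν : ∀ i, (∏ u ∈ W, w u ^ l u i) ≠ 0 := fun i =>
      Finset.prod_ne_zero_iff.mpr fun u hu => zpow_ne_zero _ (hw0 u hu)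
    have hwin2 := Torus.inScopeStateWins_C_mul_scale hwin1 (∏ u ∈ W, w u ^ m u) (fun i => ∏ u ∈ W, w u ^ l u i) hμ hν
    have hwinb : InScopeStateWins p (step p S ψ.1.j (fb ∘ ψ.1.b0 + g ∘ v) (lrowState fb row.1)) :=
      inScopeStateWins_congr hwin2 _ (by rw [hident, hF1])
    -- descend to `K`
    refine ScopeSymmetry.inScopeStateWins_of_inScopeStateWins_map g p ?_
    rw [hchild]
    exact hwinb
  -- every flat (ordinary or torus) of chart `j` absorbs every `K`-point on it
  have hanyflat : ∀ (j : Fin 4) (φ : Flat (ZMod p)), φ ∈ allFlats row → φ.j = j → ∀ b : Fin 4 → K, OnFlat f φ b →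
      InScopeStateWins p (step p S j b (lrowState f row.1)) := by
    intro j φ hφ hφj b hb
    unfold allFlats at hφ
    rcases List.mem_append.mp hφ with h | h
    · exact hflat j φ h hφj b hb
    · obtain ⟨ψ, hψ, rfl⟩ := List.mem_map.mp h
      exact htflat j ψ hψ hφj b hb
  -- a leaf of chart `j` gives a blind child at every `K`-point on it
  have hleaf : ∀ (j : Fin 4) (ℓ : ILeaf (ZMod p) C), ℓ ∈ row.1.2.2.2 → ℓ.j = j → ∀ b : Fin 4 → K, b j = 0 →
      OnLeaf f ℓ b → InScopeStateWins p (step p S j b (lrowState f row.1)) := by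
    intro j ℓ hℓ hℓj b hbj hb
    obtain ⟨-, hok⟩ := hleaves' ℓ hℓ
    refine inScopeStateWins_of_not_inCoordinateScope ?_
    rw [← hℓj]
    exact hs srow S ℓ hok K f b (by rw [hℓj]; exact hbj) hb
  rintro s' ⟨j, b, hj, hbj, heq, hne, rfl⟩
  have h0 : ∀ φ : Flat (ZMod p), φ ∈ allFlats row → φ.b0 φ.j = 0 := by
    intro φ hφ
    unfold allFlats at hφ
    rcases List.mem_append.mp hφ with h | h
    · exact (hflats' φ h).2.1
    · obtain ⟨ψ, hψ, rfl⟩ := List.mem_map.mp h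
      exact (of_ltorusFlatOKB (htor ψ hψ)).2.1
  rcases rational_or_onFlat_or_onILeaf f (hcov' j hj) h0 hbj heq with
    ⟨b₀, hb₀j, rfl⟩ | ⟨φ, hφ, hφj, hon⟩ | ⟨ℓ, hℓ, hℓj, hon⟩
  · -- a rational reply
    rcases hall' j hj b₀ hb₀j with h | ⟨φ, hφ, hφj, honB⟩ | ⟨ℓ, hℓ, hℓj, honB⟩
    · have heq₀ : IsEquimultiplePoint p S j b₀ srow.toState :=
        (BaseChange.isEquimultiplePoint_map_ringHom_iff f p S j b₀ srow.toState).mp heq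
      have hstep := BaseChange.step_map f p S j b₀ srow.toState
      unfold ireplyOK at h
      rw [Bool.or_eq_true, Bool.or_eq_true] at h
      rcases h with (h1 | h2) | h3
      · rw [Bool.not_eq_true', ← Bool.not_eq_true] at h1
        exact absurd ((isEquimultiplePoint_iff p S j b₀ srow).mp heq₀) h1
      · exfalso
        apply hne
        show (step p S j (f ∘ b₀) (lrowState f row.1)).F = 0
        rw [lrowState, hstep]
        show MvPolynomial.map f (step p S j b₀ srow.toState).F = 0
        have hz : (step p S j b₀ srow.toState).F = 0 := by
          by_contra hnz
          have := (step_F_ne_zero_iff p S j b₀ srow).mp hnz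
          rw [h2] at this
          exact Bool.noConfusion this
        rw [hz, map_zero]
      · obtain ⟨r, hr, hrc⟩ := exists_of_ichildIn h3
        obtain ⟨ur, hur, rfl⟩ := List.mem_map.mp hr
        show InScopeStateWins p (step p S j (f ∘ b₀) (lrowState f row.1))
        rw [lrowState, hstep, step_toState, hrc]
        exact (hrest ur hur).1
    · exact hanyflat j φ hφ hφj _ (onFlat_of_onFlatB f honB)
    · exact hleaf j ℓ hℓ hℓj _ (by rw [Function.comp_apply, hb₀j, map_zero]) (onLeaf_of_onLeafBL f honB)
  · exact hanyflat j φ hφ hφj b hon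
  · exact hleaf j ℓ hℓ hℓj b hbj hon

/-- **SOUNDNESS of one row over `K`** (torus format). [folklore] -/
theorem trowGood_of_trowOK {p : ℕ} [Fact p.Prime] {K : Type} [Field K] [CharP K p] [DecidableEq K]
    (f : ZMod p →+* K) {leafOK : SData 4 (ZMod p) → Finset (Fin 4) → ILeaf (ZMod p) C → Bool}
    (hs : LeafSound p leafOK) {rest : List (TRow (ZMod p) C)} (hrestAll : AllGood p rest) {row : TRow (ZMod p) C}
    (h : trowOKL p p leafOK rest row = true) : LRowGood f row.1 := by
  classical
  unfold trowOKL at h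
  rw [Bool.or_eq_true, Bool.or_eq_true] at h
  rcases h with (hb | ht) | hm
  · -- a blindness certificate (monomial or rational curve)
    have hsome : row.1.1.2.2 ≠ none := by
      unfold lblindOKS at hb
      obtain ⟨⟨⟨s, S, oβ⟩, ws, fl, lv⟩, tf⟩ := row
      rcases oβ with _ | ⟨c, w, α₀, a⟩ | ⟨P, v, D, kk, α₀, a⟩
      · exact absurd hb Bool.false_ne_true
      · exact Option.some_ne_none _
      · exact Option.some_ne_none _
    refine ⟨?_, fun hnone => absurd hnone hsome⟩
    unfold lblindOKS at hb
    obtain ⟨⟨⟨s, S, oβ⟩, ws, fl, lv⟩, tf⟩ := row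
    rcases oβ with _ | ⟨c, w, α₀, a⟩ | ⟨P, v, D, kk, α₀, a⟩
    · exact absurd hb Bool.false_ne_true
    · exact inScopeStateWins_of_not_inCoordinateScope (not_inCoordinateScope_map_of_blindB f hb)
    · exact inScopeStateWins_of_not_inCoordinateScope (ScopeBlind.not_inCoordinateScope_map_of_rblindB (f := f) hb)
  · -- origin not `p`-fold
    rw [Bool.not_eq_true'] at ht
    constructor
    · refine inScopeStateWins_of_no_permissible fun S hS => ?_
      exact no_permissible_of_not_permB ht S ((BaseChange.isPermissibleCentre_map_iff f p S _).mp hS)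
    · intro _ huniv
      rw [ht] at huniv
      exact absurd huniv Bool.false_ne_true
  · simp only [Bool.and_eq_true, decide_eq_true_eq] at hm
    obtain ⟨⟨⟨⟨⟨hS, hall⟩, hflats⟩, htor⟩, hleaves⟩, hcov⟩ := hm
    have hperm : IsPermissibleCentre p row.1.1.2.1 row.1.1.1.toState.F :=
      (isPermissibleCentre_iff p row.1.1.2.1 row.1.1.1.L).mpr hS
    have hperm' : IsPermissibleCentre p row.1.1.2.1 (lrowState f row.1).F :=
      (BaseChange.isPermissibleCentre_map_iff f p row.1.1.2.1 _).mpr hperm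
    have hedges := tedges_of_move f hs hrestAll hall hflats htor hleaves hcov
    exact ⟨inScopeStateWins_move row.1.1.2.1 hperm' hedges, fun _ _ => ⟨hperm', hedges⟩⟩

/-! ## 2. Soundness of a certificate over every field of characteristic `p` -/

/-- **SOUNDNESS OVER EVERY FIELD OF CHARACTERISTIC `p`** (torus format): every row of a checked certificate is good
along every base change. [folklore] -/
theorem allGood_of_twinCertBL {p : ℕ} [Fact p.Prime]
    {leafOK : SData 4 (ZMod p) → Finset (Fin 4) → ILeaf (ZMod p) C → Bool} (hs : LeafSound p leafOK) :
    ∀ {T : List (TRow (ZMod p) C)}, twinCertBL p p leafOK T = true → AllGood p T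
  | [], _ => fun K _ _ _ f row hrow => absurd hrow List.not_mem_nil
  | row :: rest, h => by
    unfold twinCertBL at h
    rw [Bool.and_eq_true] at h
    have hrest : AllGood p rest := allGood_of_twinCertBL hs h.2
    intro K _ _ _ f r hr
    rcases List.mem_cons.mp hr with rfl | hr'
    · exact trowGood_of_trowOK f hs hrest h.1
    · exact hrest K f r hr'

/-- **`∀ K` form**: for a SOUND leaf oracle and every field `K` of characteristic `p`, every row state `⊗ K` of a
certificate passing the torus checker is IN-SCOPE ESCAPABLE (`InScopeStateWins p`: the F4-C game at `(p, p)`,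
player B ranging over ALL of `K⁴`). [folklore] -/
theorem forall_inScopeStateWins_of_twinCertBL {p : ℕ} [Fact p.Prime]
    {leafOK : SData 4 (ZMod p) → Finset (Fin 4) → ILeaf (ZMod p) C → Bool} (hs : LeafSound p leafOK)
    {T : List (TRow (ZMod p) C)} (h : twinCertBL p p leafOK T = true) (K : Type) [Field K] [CharP K p]
    [DecidableEq K] :
    ∀ row ∈ T, InScopeStateWins p
      (⟨MvPolynomial.map (ZMod.castHom (dvd_refl p) K) row.1.1.1.toState.F, row.1.1.1.toState.r,
        row.1.1.1.toState.exc⟩ : State K) :=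
  fun row hrow => (allGood_of_twinCertBL hs h K (ZMod.castHom (dvd_refl p) K) row hrow).1

/-- **`∀ K` form for the five leaf kinds** (`leafOK5`, ✓ `leafSound5`) with torus flats, still flats and `.rat`
blind rows. [folklore] -/
theorem forall_inScopeStateWins_of_twinCertBL5 {T : List (TRow (ZMod 2) (LeafCert5 (ZMod 2)))}
    (h : twinCertBL 2 2 leafOK5 T = true) (K : Type) [Field K] [CharP K 2] [DecidableEq K] :
    ∀ row ∈ T, InScopeStateWins 2
      (⟨MvPolynomial.map (ZMod.castHom (dvd_refl 2) K) row.1.1.1.toState.F, row.1.1.1.toState.r,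
        row.1.1.1.toState.exc⟩ : State K) :=
  forall_inScopeStateWins_of_twinCertBL leafSound5 h K

end WinCertLeaf

end Summit.ResolutionOfSingularities.ResolutionOfSingularities.Theorems.PIDim4

end
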